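import Summits.CriticalPhenomena.PercolationContinuityZ3.Theorems.PercAnnulusCrossingIICVolumeExponentExists
import HarnessLib

/-!
# `|C(0) ∩ Λ(n)| = n² π_{1/2}(n)` UP TO POLYLOGARITHMIC FACTORS, ALMOST SURELY, for Kesten's planar IIC (lane RSW3, p1 gen 16)

builds on p205010 (kernel theorem, internal audit signed; external expert review pending) — NOT used in this file (`ℤ²` at `p_c = 1/2`).

Seat `prim-rsw3-p1` (gen 16); memo `run/shared/lean/prim/rsw3/P1-QM.md` §29.  Helper file for the crux `stmt-CriticalPhenomena-4575` chain; no
definitions, no sorries.  gen 14 proved the a.s. upper envelope `V_n ≤ n^δ · n²π(n)` and gen 16 (`…IICVolumeExponentExists`) the lower envelope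
`n²π(n) ≤ n^δ V_n`, for every `δ > 0`.  Both tails are in fact much better than needed for powers of `n`: the upper tail is `≤ C/λ` (Markov, p2 GEN 21)
and the lower tail is `≤ Cε^c` (gen 16), so Borel–Cantelli along `n = 2^m` with POLYLOGARITHMIC levels already converges:

* **`iicMeasure_ae_eventually_volume_le_log_sq_Z2`** — for EVERY measure `ν` with Kesten's IIC limit property at `p_c(ℤ²) = 1/2`: `ν`-a.s. eventually
  **`V_n ≤ 16 (1 + log n)² · n² π_{1/2}(n)`**;
* **`iicMeasure_ae_eventually_volume_ge_div_log_pow_Z2`** — there are `A, C > 0` (lattice constants) with, for every such `ν`: `ν`-a.s. eventually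
  **`n² π_{1/2}(n) ≤ A (1 + log n)^C · V_n`**;
* **`iicMeasure_ae_eventually_abs_log_volume_sub_le_Z2`** — hence `ν`-a.s. **`|log V_n − log(n²π_{1/2}(n))| ≤ C·(1 + log(1 + log n))` eventually**:
  Kesten's `|C ∩ Λ(n)| ≍ n²π_n` holds ALMOST SURELY up to `log log` corrections in the exponent — a quenched form of Kesten's Theorem (8).
References: H. Kesten, PTRF 73 (1986), Thm. (8).
-/

noncomputable section

namespace Summit.CriticalPhenomena.PercolationContinuityZ3.Theorems.Crossing

open MeasureTheory Filter Topology Literature.Probability.Percolation Literature.Probability.LatticeModels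
open Literature.Probability.Percolation.DCT16 Literature.Probability.Percolation.DKT20
open scoped Literature.Probability.Percolation ENNReal

/-! ## The dyadic index of `n` is `≤ 2 log n` -/

/-- For `2^m ≤ n` (`n ≥ 1`): `m ≤ 2 log n`, so `m + 2 ≤ 2(1 + log n)`. [folklore] -/
theorem natLog_le_two_mul_log {m n : ℕ} (h : 2 ^ m ≤ n) : (m : ℝ) + 2 ≤ 2 * (1 + Real.log n) := by
  have hn : (0 : ℝ) < n := by
    have : 1 ≤ n := le_trans Nat.one_le_two_pow h
    exact_mod_cast this
  have h1 : (m : ℝ) * Real.log 2 ≤ Real.log n := by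
    rw [← Real.log_pow]
    exact Real.log_le_log (by positivity) (by exact_mod_cast h)
  have h2 : (1 : ℝ) / 2 < Real.log 2 := by linarith [Real.log_two_gt_d9]
  have hm0 : (0 : ℝ) ≤ m := Nat.cast_nonneg m
  nlinarith

/-! ## The upper envelope with a `log²` factor -/

open Classical in
/-- **A.S. UPPER ENVELOPE `V_n ≤ 16(1 + log n)² n² π_{1/2}(n)`** for Kesten's planar IIC (every IIC measure `ν` at `p_c(ℤ²)`): Borel–Cantelli on the
Markov bound `ν(λ n²π(n) ≤ V_n) ≤ C/λ` (p2 GEN 21) along `n = 2^m` with `λ = (m+1)²`, and monotonicity. [cite: Kesten1986, Thm. (8)] -/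
theorem iicMeasure_ae_eventually_volume_le_log_sq_Z2 {ν : Measure (BondConfig (Site 2))} [IsProbabilityMeasure ν]
    (hν : ∀ (F : Finset (Sym2 (Site 2))) (E : Set (BondConfig (Site 2))), MeasurableSet E → DeterminedBy E ↑F →
      Tendsto (fun n : ℕ => (bondPercolation (zdGraph 2) (criticalProbI 2)).real (E ∩ siteToBoundary 2 n) /
        oneArmProb 2 (criticalProbI 2) n) atTop (𝓝 (ν.real E))) :
    ∀ᵐ ω ∂ν, ∀ᶠ n : ℕ in atTop,
      ((((box 2 n).filter fun z => ω ∈ (openConn (0 : Site 2) z : Set (BondConfig (Site 2)))).card : ℕ) : ℝ) ≤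
        16 * (1 + Real.log n) ^ 2 * ((n : ℝ) ^ 2 * oneArmProb 2 (criticalProbI 2) n) := by
  classical
  obtain ⟨ϰ, hϰ, hA2⟩ := exists_setToSetQuasiMultAspectAt_two_of_criticalProbI_le
  obtain ⟨C, hC, hup⟩ := Rsw3.iicMeasure_real_volume_ge_le (d := 2) le_rfl (by norm_num) (by norm_num) hϰ (hA2 _ le_rfl) 0
  set D : ℕ → Set (BondConfig (Site 2)) := fun m =>
    {ω | ((m : ℝ) + 1) ^ 2 * (((2 ^ m : ℕ) : ℝ) ^ 2 * oneArmProb 2 (criticalProbI 2) (2 ^ m)) ≤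
      ((((box 2 (2 ^ m)).filter fun z => ω ∈ (openConn (0 : Site 2) z : Set (BondConfig (Site 2)))).card : ℕ) : ℝ)} with hD
  have hBC : ∀ᵐ ω ∂ν, ∀ᶠ m in atTop, ω ∉ D m := by
    refine ae_eventually_not_mem_of_real_le ν D (fun m => C / ((m : ℝ) + 1) ^ 2) (fun m => by positivity) ?_ fun m => ?_
    · have h := (summable_nat_add_iff 1).2 ((Real.summable_one_div_nat_pow).2 one_lt_two)
      simpa [div_eq_mul_one_div C] using h.mul_left C
    · have h := hup ν hν (2 ^ m) (((m : ℝ) + 1) ^ 2) Nat.one_le_two_pow (by positivity)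
      simp only [zero_add, pow_one] at h
      exact h
  filter_upwards [hBC] with ω hω
  obtain ⟨m₀, hm₀⟩ := hω.exists_forall_of_atTop
  refine (eventually_ge_atTop (2 ^ m₀)).mono fun n hn => ?_
  have hn1 : 1 ≤ n := le_trans Nat.one_le_two_pow hn
  have hn0 : (0 : ℝ) < n := by exact_mod_cast hn1
  obtain ⟨m, hm⟩ : ∃ m : ℕ, m = Nat.log 2 n := ⟨_, rfl⟩
  have hm₀m : m₀ ≤ m := by rw [hm]; exact Nat.le_log_of_pow_le (by norm_num) hn
  have h2m : 2 ^ m ≤ n := by rw [hm]; exact Nat.pow_log_le_self 2 (by omega)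
  have hn2 : n < 2 ^ (m + 1) := by rw [hm]; exact Nat.lt_pow_succ_log_self (by norm_num) n
  have hgood := hm₀ (m + 1) (by omega)
  simp only [hD, Set.mem_setOf_eq, not_le] at hgood
  have hV := card_filter_openConn_mono (d := 2) hn2.le ω
  have hV' : ((((box 2 n).filter fun z => ω ∈ (openConn (0 : Site 2) z : Set (BondConfig (Site 2)))).card : ℕ) : ℝ) ≤
      ((((box 2 (2 ^ (m + 1))).filter fun z => ω ∈ (openConn (0 : Site 2) z : Set (BondConfig (Site 2)))).card : ℕ) : ℝ) := by
    exact_mod_cast hV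
  have hπ : oneArmProb 2 (criticalProbI 2) (2 ^ (m + 1)) ≤ oneArmProb 2 (criticalProbI 2) n := DCT16.real_siteToBoundary_antitone _ hn2.le
  have hπ0 : 0 ≤ oneArmProb 2 (criticalProbI 2) (2 ^ (m + 1)) := measureReal_nonneg
  have hpow : (((2 ^ (m + 1) : ℕ) : ℝ)) ≤ 2 * (n : ℝ) := by
    have : ((2 ^ (m + 1) : ℕ) : ℝ) = 2 * ((2 ^ m : ℕ) : ℝ) := by push_cast; ring
    rw [this]; exact_mod_cast Nat.mul_le_mul_left 2 h2m
  have hlog : ((m + 1 : ℕ) : ℝ) + 1 ≤ 2 * (1 + Real.log n) := by push_cast; linarith [natLog_le_two_mul_log h2m]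
  have hlog0 : 0 ≤ ((m + 1 : ℕ) : ℝ) + 1 := by positivity
  calc ((((box 2 n).filter fun z => ω ∈ (openConn (0 : Site 2) z : Set (BondConfig (Site 2)))).card : ℕ) : ℝ)
      ≤ (((m + 1 : ℕ) : ℝ) + 1) ^ 2 * ((((2 ^ (m + 1) : ℕ) : ℝ)) ^ 2 * oneArmProb 2 (criticalProbI 2) (2 ^ (m + 1))) := hV'.trans hgood.le
    _ ≤ (2 * (1 + Real.log n)) ^ 2 * ((2 * (n : ℝ)) ^ 2 * oneArmProb 2 (criticalProbI 2) n) := by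
        refine mul_le_mul (pow_le_pow_left₀ hlog0 hlog 2) (mul_le_mul (pow_le_pow_left₀ (by positivity) hpow 2) hπ hπ0 (by positivity))
          (mul_nonneg (sq_nonneg _) hπ0) (by positivity)
    _ = 16 * (1 + Real.log n) ^ 2 * ((n : ℝ) ^ 2 * oneArmProb 2 (criticalProbI 2) n) := by ring

/-! ## The lower envelope with a polylogarithmic factor -/

open Classical in
/-- **A.S. LOWER ENVELOPE `n² π_{1/2}(n) ≤ A(1 + log n)^C V_n`** for Kesten's planar IIC: there are `A, C > 0` such that for every IIC measure `ν` at
`p_c(ℤ²)`, `ν`-a.s. eventually `n²π(n) ≤ A(1 + log n)^C · |C(0) ∩ Λ(n)|` (Borel–Cantelli on the power-law lower tail along `n = 2^m` with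
`ε_m = (m+1)^{−2/c}`). [cite: Kesten1986, Thm. (8)] -/
theorem iicMeasure_ae_eventually_volume_ge_div_log_pow_Z2 :
    ∃ A C : ℝ, 0 < A ∧ 0 < C ∧ ∀ (ν : Measure (BondConfig (Site 2))) [IsProbabilityMeasure ν],
      (∀ (F : Finset (Sym2 (Site 2))) (E : Set (BondConfig (Site 2))), MeasurableSet E → DeterminedBy E ↑F →
        Tendsto (fun n : ℕ => (bondPercolation (zdGraph 2) (criticalProbI 2)).real (E ∩ siteToBoundary 2 n) /
          oneArmProb 2 (criticalProbI 2) n) atTop (𝓝 (ν.real E))) →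
      ∀ᵐ ω ∂ν, ∀ᶠ n : ℕ in atTop, ((n : ℝ) ^ 2 * oneArmProb 2 (criticalProbI 2) n) ≤
        A * (1 + Real.log n) ^ C * ((((box 2 n).filter fun z => ω ∈ (openConn (0 : Site 2) z : Set (BondConfig (Site 2)))).card : ℕ) : ℝ) := by
  classical
  obtain ⟨C, c, hC, hc, htail⟩ := iicMeasure_real_volume_le_le_rpow_Z2
  refine ⟨(2 : ℝ) ^ (2 / c), 2 / c, by positivity, by positivity, fun ν _ hν => ?_⟩
  -- levels `ε_m = (m+1)^{-2/c}` along `n = 2^m`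
  set D : ℕ → Set (BondConfig (Site 2)) := fun m =>
    {ω | ((((box 2 (2 ^ m)).filter fun z => ω ∈ (openConn (0 : Site 2) z : Set (BondConfig (Site 2)))).card : ℕ) : ℝ) ≤
      ((m : ℝ) + 1) ^ (-(2 / c)) * (2 * ((2 ^ m : ℕ) : ℝ) + 1) ^ 2 * oneArmProb 2 (criticalProbI 2) (2 ^ m)} with hD
  have hBC : ∀ᵐ ω ∂ν, ∀ᶠ m in atTop, ω ∉ D m := by
    refine ae_eventually_not_mem_of_real_le ν D (fun m => C / ((m : ℝ) + 1) ^ 2) (fun m => by positivity) ?_ fun m => ?_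
    · have h := (summable_nat_add_iff 1).2 ((Real.summable_one_div_nat_pow).2 one_lt_two)
      simpa [div_eq_mul_one_div C] using h.mul_left C
    · have h := htail ν hν (2 ^ m) Nat.one_le_two_pow (((m : ℝ) + 1) ^ (-(2 / c))) (by positivity)
      have hε : (((m : ℝ) + 1) ^ (-(2 / c))) ^ c = 1 / ((m : ℝ) + 1) ^ 2 := by
        rw [← Real.rpow_mul (by positivity), show -(2 / c) * c = -(2 : ℝ) by field_simp, Real.rpow_neg (by positivity),
          one_div, Real.rpow_two]
      rw [hε, ← div_eq_mul_one_div] at h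
      exact h
  filter_upwards [hBC] with ω hω
  obtain ⟨m₀, hm₀⟩ := hω.exists_forall_of_atTop
  refine (eventually_ge_atTop (2 ^ m₀)).mono fun n hn => ?_
  have hn1 : 1 ≤ n := le_trans Nat.one_le_two_pow hn
  have hn0 : (0 : ℝ) < n := by exact_mod_cast hn1
  obtain ⟨m, hm⟩ : ∃ m : ℕ, m = Nat.log 2 n := ⟨_, rfl⟩
  have hm₀m : m₀ ≤ m := by rw [hm]; exact Nat.le_log_of_pow_le (by norm_num) hn
  have h2m : 2 ^ m ≤ n := by rw [hm]; exact Nat.pow_log_le_self 2 (by omega)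
  have hn2 : n < 2 ^ (m + 1) := by rw [hm]; exact Nat.lt_pow_succ_log_self (by norm_num) n
  have hgood := hm₀ m hm₀m
  simp only [hD, Set.mem_setOf_eq, not_le] at hgood
  have hV := card_filter_openConn_mono (d := 2) h2m ω
  have hV' : ((((box 2 (2 ^ m)).filter fun z => ω ∈ (openConn (0 : Site 2) z : Set (BondConfig (Site 2)))).card : ℕ) : ℝ) ≤
      ((((box 2 n).filter fun z => ω ∈ (openConn (0 : Site 2) z : Set (BondConfig (Site 2)))).card : ℕ) : ℝ) := by exact_mod_cast hV
  have hπ : oneArmProb 2 (criticalProbI 2) n ≤ oneArmProb 2 (criticalProbI 2) (2 ^ m) := DCT16.real_siteToBoundary_antitone _ h2m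
  have hπ0 : 0 ≤ oneArmProb 2 (criticalProbI 2) n := measureReal_nonneg
  have hsq : (n : ℝ) ^ 2 ≤ (2 * ((2 ^ m : ℕ) : ℝ) + 1) ^ 2 := by
    have : (n : ℝ) ≤ 2 * ((2 ^ m : ℕ) : ℝ) + 1 := by
      have h' : ((n : ℕ) : ℝ) < ((2 ^ (m + 1) : ℕ) : ℝ) := by exact_mod_cast hn2
      push_cast at h' ⊢; rw [pow_succ] at h'; linarith
    exact pow_le_pow_left₀ hn0.le this 2
  -- `(m+1)^{2/c} ≤ (2(1+log n))^{2/c} = 2^{2/c} (1 + log n)^{2/c}`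
  have hm1 : (m : ℝ) + 1 ≤ 2 * (1 + Real.log n) := by linarith [natLog_le_two_mul_log h2m]
  have hlogn : 0 ≤ Real.log n := Real.log_nonneg (by exact_mod_cast hn1)
  have hfac : ((m : ℝ) + 1) ^ (2 / c) ≤ (2 : ℝ) ^ (2 / c) * (1 + Real.log n) ^ (2 / c) := by
    rw [← Real.mul_rpow (by norm_num) (by positivity)]
    exact Real.rpow_le_rpow (by positivity) hm1 (by positivity)
  have hεpos : 0 < ((m : ℝ) + 1) ^ (-(2 / c)) := Real.rpow_pos_of_pos (by positivity) _
  have hinv : ((m : ℝ) + 1) ^ (2 / c) * ((m : ℝ) + 1) ^ (-(2 / c)) = 1 := by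
    rw [Real.rpow_neg (by positivity), mul_inv_cancel₀ (Real.rpow_pos_of_pos (by positivity) _).ne']
  -- assemble: `n²π(n) ≤ (2·2^m+1)² π(2^m) = (m+1)^{2/c} · [ε_m (2·2^m+1)² π(2^m)] < (m+1)^{2/c} V_{2^m} ≤ …`
  calc (n : ℝ) ^ 2 * oneArmProb 2 (criticalProbI 2) n
      ≤ (2 * ((2 ^ m : ℕ) : ℝ) + 1) ^ 2 * oneArmProb 2 (criticalProbI 2) (2 ^ m) := mul_le_mul hsq hπ hπ0 (by positivity)
    _ = ((m : ℝ) + 1) ^ (2 / c) * (((m : ℝ) + 1) ^ (-(2 / c)) * (2 * ((2 ^ m : ℕ) : ℝ) + 1) ^ 2 * oneArmProb 2 (criticalProbI 2) (2 ^ m)) := by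
        rw [← mul_assoc, ← mul_assoc, hinv, one_mul]
    _ ≤ ((m : ℝ) + 1) ^ (2 / c) * ((((box 2 n).filter fun z => ω ∈ (openConn (0 : Site 2) z : Set (BondConfig (Site 2)))).card : ℕ) : ℝ) :=
        mul_le_mul_of_nonneg_left (hgood.le.trans hV') (by positivity)
    _ ≤ (2 : ℝ) ^ (2 / c) * (1 + Real.log n) ^ (2 / c) *
          ((((box 2 n).filter fun z => ω ∈ (openConn (0 : Site 2) z : Set (BondConfig (Site 2)))).card : ℕ) : ℝ) :=
        mul_le_mul_of_nonneg_right hfac (Nat.cast_nonneg _)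

/-! ## Kesten's `|C ∩ Λ(n)| ≍ n²π_n` almost surely up to `log log n` in the exponent -/

open Classical in
/-- **QUENCHED KESTEN (8): `|log V_n − log(n²π_{1/2}(n))| ≤ C(1 + log(1 + log n))` EVENTUALLY, A.S.** — there is `C > 0` such that for every
measure `ν` with Kesten's IIC limit property at `p_c(ℤ²)`, `ν`-a.s. for all large `n` the volume of the IIC in `Λ(n)` is `n²π_{1/2}(n)` up to a
polylogarithmic factor. [cite: Kesten1986, Thm. (8)] -/
theorem iicMeasure_ae_eventually_abs_log_volume_sub_le_Z2 :
    ∃ C : ℝ, 0 < C ∧ ∀ (ν : Measure (BondConfig (Site 2))) [IsProbabilityMeasure ν],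
      (∀ (F : Finset (Sym2 (Site 2))) (E : Set (BondConfig (Site 2))), MeasurableSet E → DeterminedBy E ↑F →
        Tendsto (fun n : ℕ => (bondPercolation (zdGraph 2) (criticalProbI 2)).real (E ∩ siteToBoundary 2 n) /
          oneArmProb 2 (criticalProbI 2) n) atTop (𝓝 (ν.real E))) →
      ∀ᵐ ω ∂ν, ∀ᶠ n : ℕ in atTop,
        |Real.log ((((box 2 n).filter fun z => ω ∈ (openConn (0 : Site 2) z : Set (BondConfig (Site 2)))).card : ℕ) : ℝ) -
          Real.log ((n : ℝ) ^ 2 * oneArmProb 2 (criticalProbI 2) n)| ≤ C * (1 + Real.log (1 + Real.log n)) := by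
  classical
  obtain ⟨A, C, hA, hC, hlow⟩ := iicMeasure_ae_eventually_volume_ge_div_log_pow_Z2
  have hpc0 : 0 < ((criticalProbI 2 : unitInterval) : ℝ) := by
    rw [SubpolynomialBlocking.StubBlockProbTwoPos.criticalProbI_two_eq_half, coe_half]; norm_num
  refine ⟨max (Real.log 16 + 2) (|Real.log A| + C), lt_max_of_lt_left (by positivity), fun ν _ hν => ?_⟩
  filter_upwards [iicMeasure_ae_eventually_volume_le_log_sq_Z2 hν, hlow ν hν] with ω hup hlo
  refine ((hup.and hlo).and (eventually_ge_atTop 1)).mono fun n hn => ?_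
  obtain ⟨⟨h1, h2⟩, hn1⟩ := hn
  have hn0 : (0 : ℝ) < n := by exact_mod_cast hn1
  have hπ0 : 0 < oneArmProb 2 (criticalProbI 2) n := oneArmProb_pos (d := 2) (by norm_num) _ hpc0 n
  have hσ0 : 0 < (n : ℝ) ^ 2 * oneArmProb 2 (criticalProbI 2) n := mul_pos (pow_pos hn0 2) hπ0
  have hV1 : (1 : ℝ) ≤ ((((box 2 n).filter fun z => ω ∈ (openConn (0 : Site 2) z : Set (BondConfig (Site 2)))).card : ℕ) : ℝ) := by
    exact_mod_cast one_le_card_filter_openConn_zero n ω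
  obtain ⟨V, hV⟩ : ∃ V : ℝ, V = ((((box 2 n).filter fun z => ω ∈ (openConn (0 : Site 2) z : Set (BondConfig (Site 2)))).card : ℕ) : ℝ) :=
    ⟨_, rfl⟩
  obtain ⟨σ, hσ⟩ : ∃ σ : ℝ, σ = (n : ℝ) ^ 2 * oneArmProb 2 (criticalProbI 2) n := ⟨_, rfl⟩
  rw [← hV] at h1 h2 hV1 ⊢
  rw [← hσ] at h1 h2 ⊢
  rw [← hσ] at hσ0
  have hlogn : 0 ≤ Real.log n := Real.log_nonneg (by exact_mod_cast hn1)
  have hL0 : 0 ≤ Real.log (1 + Real.log n) := Real.log_nonneg (by linarith)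
  have hL1 : (1 : ℝ) ≤ 1 + Real.log n := by linarith
  have hV0 : 0 < V := by linarith
  have hLC : 0 < (1 + Real.log n) ^ C := Real.rpow_pos_of_pos (by linarith) C
  obtain ⟨M, hM⟩ : ∃ M : ℝ, M = max (Real.log 16 + 2) (|Real.log A| + C) := ⟨_, rfl⟩
  rw [← hM]
  have h16 : 0 ≤ Real.log 16 := Real.log_nonneg (by norm_num)
  have hMA : Real.log A ≤ M := by rw [hM]; exact le_trans (le_abs_self _) ((le_add_of_nonneg_right hC.le).trans (le_max_right _ _))
  have hMC : C ≤ M := by rw [hM]; exact le_trans (le_add_of_nonneg_left (abs_nonneg _)) (le_max_right _ _)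
  have hM16 : Real.log 16 ≤ M := by rw [hM]; exact le_trans (by linarith) (le_max_left _ _)
  have hM2 : (2 : ℝ) ≤ M := by rw [hM]; exact le_trans (by linarith) (le_max_left _ _)
  have hCL : C * Real.log (1 + Real.log n) ≤ M * Real.log (1 + Real.log n) := mul_le_mul_of_nonneg_right hMC hL0
  have h2L : 2 * Real.log (1 + Real.log n) ≤ M * Real.log (1 + Real.log n) := mul_le_mul_of_nonneg_right hM2 hL0
  rw [abs_le]
  constructor
  · -- lower: `log σ − log V ≤ log A + C log(1+log n)`
    have h3 : Real.log σ ≤ Real.log (A * (1 + Real.log n) ^ C * V) := Real.log_le_log hσ0 h2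
    rw [Real.log_mul (mul_pos hA hLC).ne' hV0.ne', Real.log_mul hA.ne' hLC.ne', Real.log_rpow (by linarith)] at h3
    linarith
  · -- upper: `log V − log σ ≤ log 16 + 2 log(1+log n)`
    have hL2 : 0 < (1 + Real.log n) ^ 2 := by positivity
    have h3 : Real.log V ≤ Real.log (16 * (1 + Real.log n) ^ 2 * σ) := Real.log_le_log hV0 h1
    rw [Real.log_mul (by positivity) hσ0.ne', Real.log_mul (by norm_num) hL2.ne', Real.log_pow] at h3
    push_cast at h3
    linarith

end Summit.CriticalPhenomena.PercolationContinuityZ3.Theorems.Crossing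

end
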